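import Summits.AtomisticToContinuum.BoseEinsteinCondensation.Theses.BECStronglyRayleigh

/-!
# Sketch — crux idea `tagged-particle-roughness-domination` for LatticeToPeriodicBridge
(stmt-AtomisticToContinuum-9674)

Ideator k = 2 (gen 2), round 1. Objects, first lemmas and the typed bet of the line; nothing here is
a route item.

THE LEVER. On BOTH sides of the bridge the order parameter is `N ×` the mean squared Bhattacharyya
flatness of the INSERTION LAW of one tagged particle given the others:

* lattice (hard-core bosons = spin ½, occupied = index `0`): for any vector `ψ = Σ_S φ(S) |1_S⟩`,
  `S⁻_tot ψ = Σ_T (Σ_{x∉T} φ(T ∪ {x})) |1_T⟩`, hence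
  `⟨ψ, S⁺_tot S⁻_tot ψ⟩ = ⟨ψ, ((S¹_tot)² + (S²_tot)² + S³_tot) ψ⟩ = Σ_T |Σ_{x∉T} φ(T∪{x})|²`
  (`LatticeZeroModeIsInsertionNorm`, a finite identity). For `φ ≥ 0` on `N`-sets this reads
  `n₀^latt := ⟨S⁺S⁻⟩/|Λ| = N · E_Z[BC_T²]`, `BC_T² = (Σ_x √p_T(x))²/|Λ|`, `p_T(x) ∝ φ(T∪x)²`,
  weights `Z_T = Σ_x φ(T∪x)²`, `Σ_T Z_T = N`.
* continuum (torus of side `L`, grid of `M³` cells of side `b = L/M`, flat cell modes `χ_m`): for a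
  nonnegative periodic `Ψ`, `⟨φ₀, γ_Ψ φ₀⟩ = N M⁻³ ∫ dY (Σ_m A_m(Y))²` with the cell amplitudes
  `A_m(Y) = ⟨χ_m, Ψ(·,Y)⟩ ≥ 0` (`CondensateIsCellAmplitudeNorm`), i.e.
  `n₀^cont = N_b · E_{w'}[BC²(π_Y, u_M)]`, `π_Y(m) ∝ A_m(Y)²`, `N_b = Σ_m ⟨χ_m, γ χ_m⟩ ≥ N − (b²/π²)T`.

Same Schur-concave functional `BC²`, same grid, two insertion laws. The bridge is placed at the
DILUTE EDGE: a FIXED microscopic grid `b ≥ b⋆(v) := a(v)/a₁`, `a₁ = 1/(4π G(0)) = 0.3148…` the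
hard-core lattice scattering length in lattice units (Watson `G(0) = 0.25273`), so that the lattice
gas at filling `ν = ρ b³ → 0` has scattering length `a₁ b ≥ a(v)` and its insertion log-amplitude
is ROUGHER than the continuum one at every scale (exclusion ⊇ softened core; deeper two-body dips;
larger phonon tilt `∝ a^{3/2}ρ^{1/2}`). Roughness domination ⇒ (independent-tilt coupling) ⇒
multiplicativity of flatness `E BC²(q·e^{-Ψ}) ≈ E BC²(q) · BC²(e^{-Ψ}) ≤ E BC²(q)` ⇒ the floor
`DiluteEdgeFlatnessFloor`, which with `H = KineticLatticeBEC` (consumed along `ν = ρb³ ≤ ρ₀b³`,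
uniformly in `ν` — the "all fillings" strength of `H` is used as `ν`-UNIFORMITY of `c` down to 0)
closes the crux by name (`latticeToPeriodicBridge_of_diluteEdgeFloor`, kernel-checked below).
-/

noncomputable section

open MeasureTheory Filter
open scoped ENNReal NNReal ComplexConjugate BigOperators Matrix

namespace Summit.AtomisticToContinuum.BoseEinsteinCondensation.Cruxes.LatticeToPeriodicBridge.TaggedParticleRoughnessDomination

open Literature.MathematicalPhysics.QuantumManyBody.BoseGas
open Literature.MathematicalPhysics.QuantumLattice
open Summit.AtomisticToContinuum.BoseEinsteinCondensation.Theses.BECStronglyRayleigh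

/-! ### Lattice side: the zero-mode weight is the squared ℓ¹-norm of the insertion amplitude -/

/-- The basis configuration `1_S` of hard-core bosons occupying exactly the sites of `S`
(occupied = spin up = index `0`, as in the route file). -/
def occConfig {Λ : Type*} [DecidableEq Λ] (S : Finset Λ) : TensorIndex Λ 2 :=
  fun x => if x ∈ S then 0 else 1

/-- Insertion amplitude sum `r_T = Σ_{x ∉ T} ψ(1_{T ∪ {x}})` (the `1_T`-component of `S⁻_tot ψ`). -/
def insertionSum {Λ : Type*} [Fintype Λ] [DecidableEq Λ] (ψ : TensorIndex Λ 2 → ℂ)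
    (T : Finset Λ) : ℂ :=
  ∑ x : Λ, if x ∉ T then ψ (occConfig (insert x T)) else 0

/-- Insertion mass `Z_T = Σ_{x ∉ T} |ψ(1_{T ∪ {x}})|²` (total weight of the insertion law `p_T`;
`Σ_T Z_T = N‖ψ‖²` on the `N`-particle sector). -/
def insertionMass {Λ : Type*} [Fintype Λ] [DecidableEq Λ] (ψ : TensorIndex Λ 2 → ℂ)
    (T : Finset Λ) : ℝ :=
  ∑ x : Λ, if x ∉ T then ‖ψ (occConfig (insert x T))‖ ^ 2 else 0

/-- Squared Bhattacharyya flatness `BC_T² = |r_T|² / (|Λ| Z_T) ∈ [0, 1]` of the insertion law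
`p_T(x) ∝ |ψ(1_{T∪x})|²` against the uniform law on `Λ` (for `ψ ≥ 0`; Lean's `x/0 = 0` matches
`r_T = 0` when `Z_T = 0`). Schur-concave in `p_T`. -/
def insertionFlatness {Λ : Type*} [Fintype Λ] [DecidableEq Λ] (ψ : TensorIndex Λ 2 → ℂ)
    (T : Finset Λ) : ℝ :=
  ‖insertionSum ψ T‖ ^ 2 / (Fintype.card Λ * insertionMass ψ T)

/-- FIRST LEMMA (lattice, finite identity, provable now): for EVERY vector `ψ` of the spin-½ system
on a finite `Λ`, `⟨ψ, ((S¹_tot)² + (S²_tot)² + S³_tot) ψ⟩ = ‖S⁻_tot ψ‖² = Σ_T |Σ_{x∉T} ψ(1_{T∪{x}})|²`.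
With `H`'s functional (`groundStateFunctional` of the penalised XY Hamiltonian = pure state of the
sector Perron vector, `S³_tot = N − L³/2`) this says `xyZeroModeWeight L N = Σ_T r_T²
= L³ · Σ_T Z_T · BC_T²`, i.e. `n₀^latt = N · E_Z[BC_T²]`. -/
def LatticeZeroModeIsInsertionNorm : Prop :=
  ∀ (Λ : Type) [Fintype Λ] [DecidableEq Λ] (ψ : TensorIndex Λ 2 → ℂ),
    star ψ ⬝ᵥ (totalSpin (Λ := Λ) 1 0 * totalSpin 1 0 + totalSpin 1 1 * totalSpin 1 1 +
        totalSpin 1 2) *ᵥ ψ =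
      ∑ T : Finset Λ, (((‖insertionSum ψ T‖ ^ 2 : ℝ)) : ℂ)

/-- The flatness form of the same identity (pure algebra from the previous one): for real
nonnegative `ψ`, `Σ_T |r_T|² = |Λ| · Σ_T Z_T · BC_T²`. -/
def InsertionNormIsFlatness : Prop :=
  ∀ (Λ : Type) [Fintype Λ] [DecidableEq Λ] (ψ : TensorIndex Λ 2 → ℂ),
    (∀ σ, 0 ≤ (ψ σ).re ∧ (ψ σ).im = 0) →
      ∑ T : Finset Λ, ‖insertionSum ψ T‖ ^ 2 =
        Fintype.card Λ * ∑ T : Finset Λ, insertionMass ψ T * insertionFlatness ψ T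

/-! ### Continuum side: the condensate occupation is the squared ℓ¹-norm of the cell amplitudes -/

/-- The half-open cell `∏_j [m_j b, (m_j+1) b)`, `b = L/M`, of the `M`-grid of `[0,L)³`. -/
def gridCell (L : ℝ) (M : ℕ) (m : Fin 3 → Fin M) : Set Space :=
  {x : Space | ∀ j, x j ∈ Set.Ico (((m j : ℕ) : ℝ) * (L / M)) ((((m j : ℕ) : ℝ) + 1) * (L / M))}

/-- The `L²`-normalised flat mode `χ_m = b^{-3/2} 1_{C_m}` of a grid cell. -/
def gridMode (L : ℝ) (M : ℕ) (m : Fin 3 → Fin M) : Space → ℂ :=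
  (gridCell L M m).indicator fun _ => ((Real.sqrt ((L / M) ^ 3))⁻¹ : ℂ)

/-- Cell amplitude of the tagged particle in mode `χ_m`, the other `n` particles frozen at `Y`:
`A_m(Y) = ∫ conj(χ_m)(x) Ψ(x, Y) dx` (real and `≥ 0` for `Ψ ≥ 0`). -/
def cellAmp {n : ℕ} (L : ℝ) (M : ℕ) (m : Fin 3 → Fin M) (Ψ : Config (n + 1) → ℂ)
    (Y : Config n) : ℂ :=
  ∫ x, conj (gridMode L M m x) * Ψ (Matrix.vecCons x Y)

/-- FIRST LEMMA (continuum, provable now: `constantMode L = M^{-3/2} Σ_m χ_m` on `[0,L)³` and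
linearity of the integral): for a nonnegative periodic trial state,
`condensateOccupation N L Ψ = N · M⁻³ · ∫_{[0,L)^{3n}} (Σ_m |A_m(Y)|)² dY` — the torus condensate
is `N ×` the squared `ℓ¹`-mass of the cell-amplitude vector, i.e. `n₀^cont = N_b · E_{w'}[BC²(π_Y)]`
with `π_Y(m) ∝ A_m(Y)²`, `N_b = N ∫ Σ_m A_m² = Σ_m ⟨χ_m, γ χ_m⟩`. Same functional as on the lattice. -/
def CondensateIsCellAmplitudeNorm : Prop :=
  ∀ (n M : ℕ) (L : ℝ), 0 < L → 0 < M → ∀ Ψ : PeriodicTrialState (n + 1) L,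
    (∀ X, Ψ.ψ X = (‖Ψ.ψ X‖ : ℂ)) →
      condensateOccupation (n + 1) L Ψ.ψ =
        (n + 1 : ℝ≥0∞) * ((M : ℝ≥0∞) ^ 3)⁻¹ *
          ∫⁻ Y in cellN n L, (∑ m : Fin 3 → Fin M, (‖cellAmp L M m Ψ.ψ Y‖₊ : ℝ≥0∞)) ^ 2

/-! ### `H`'s functional and the bet -/

/-- `H`'s functional verbatim: `⟨S⁺_tot S⁻_tot⟩ = ⟨(S¹_tot)² + (S²_tot)²⟩ + N − M³/2` in the tracial
ground state of the penalised XY Hamiltonian on `(ℤ/M)³` (= sector-`N` hard-core ground state):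
`M³ · n₀^latt(M, N)`. -/
def xyZeroModeWeight (M : ℕ) [NeZero M] (N : ℕ) : ℝ :=
  ((xyTorus 3 M 1 + (((3 + 1) * M ^ 3 : ℕ) : ℂ) •
      (totalSpin 1 2 + ((M : ℂ) ^ 3 / 2 - (N : ℂ)) • 1) ^ 2).groundStateFunctional
    (totalSpin 1 0 * totalSpin 1 0 + totalSpin 1 1 * totalSpin 1 1)).re + N - (M : ℝ) ^ 3 / 2

/-- THE BET `DiluteEdgeFlatnessFloor` (dilute-edge floor of the torus condensate by the hard-core
zero-mode weight on a divergent even grid). Intended witness: `K N = 2⌊L_N/(2b)⌋` for ONE fixed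
microscopic cell side `b ≥ b⋆(v) = a(v)/0.3148…` (filling `N/K(N)³ → ρb³ ≤ ρ₀ b³ < 1/2`), at
which the lattice insertion law is rougher than the continuum one at every scale; typed
existentially in `K` (weaker, still closes the crux). In flatness language (first lemmas):
`N_b/N · E_{w'}[BC²(π_Y)] + η ≥ (1−η) · E_Z[BC²(p_T)]`. -/
def DiluteEdgeFlatnessFloor : Prop :=
  ∀ v : ℝ → ℝ≥0∞, IsRepulsiveFiniteRange v → ∀ η : ℝ, 0 < η →
    ∃ ρ₀ : ℝ, 0 < ρ₀ ∧ ∀ ρ : ℝ, 0 < ρ → ρ < ρ₀ →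
      ∃ K : ℕ → ℕ, Tendsto K atTop atTop ∧ ∀ᶠ N : ℕ in atTop,
        Even (K N) ∧ 2 * N ≤ K N ^ 3 ∧ ∃ δ : ℝ≥0∞, 0 < δ ∧
          ∀ Ψ : PeriodicTrialState N (sideLength ρ N),
            periodicEnergy v Ψ ≤ periodicGroundStateEnergy v N (sideLength ρ N) + δ →
              ∀ (M : ℕ) [NeZero M], M = K N →
                ENNReal.ofReal ((1 - η) / (M : ℝ) ^ 3 * xyZeroModeWeight M N) ≤
                  condensateOccupation N (sideLength ρ N) Ψ.ψ + ENNReal.ofReal (η * N)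

/-- COMPOSITION (kernel-checked): the dilute-edge floor plus `H` decides the crux by name.
`η := min (c/4) (1/2)`; the grid `K N` is eventually `≥ L₀`, even, with `2N ≤ K(N)³`, so `H`
applies at `(L, N) = (K N, N)`; `(1−η)c − η ≥ c/4`. -/
theorem latticeToPeriodicBridge_of_diluteEdgeFloor (hF : DiluteEdgeFlatnessFloor) :
    LatticeToPeriodicBridge := by
  intro hH v hv
  obtain ⟨c, hc, L₀, hHL⟩ := hH
  set η : ℝ := min (c / 4) (1 / 2) with hηdef
  have hη0 : 0 < η := lt_min (by positivity) (by norm_num)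
  have hηc : η ≤ c / 4 := min_le_left _ _
  have hηh : η ≤ 1 / 2 := min_le_right _ _
  obtain ⟨ρ₀, hρ₀, hρ⟩ := hF v hv η hη0
  refine ⟨ρ₀, hρ₀, fun ρ hρpos hρlt => ⟨c / 4, by positivity, ?_⟩⟩
  obtain ⟨K, hK, hev⟩ := hρ ρ hρpos hρlt
  filter_upwards [hev, hK.eventually_ge_atTop (max L₀ 1), eventually_ge_atTop 1] with N hN hKN hN1
  obtain ⟨hEven, h2N, δ, hδ, hΨ⟩ := hN
  refine ⟨δ, hδ, fun Ψ hE => ?_⟩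
  have hK1 : 1 ≤ K N := le_trans (le_max_right _ _) hKN
  have hKL : L₀ ≤ K N := le_trans (le_max_left _ _) hKN
  haveI : NeZero (K N) := ⟨by omega⟩
  -- the two inputs
  have hfloor := hΨ Ψ hE (K N) rfl
  have hlat : c * N * ((K N : ℕ) : ℝ) ^ 3 ≤ xyZeroModeWeight (K N) N := hHL (K N) hKL hEven N hN1 h2N
  -- arithmetic
  have hMpos : (0 : ℝ) < ((K N : ℕ) : ℝ) ^ 3 := by positivity
  have h1η : 0 < 1 - η := by linarith
  have hkey : c / 4 * N + η * N ≤ (1 - η) / ((K N : ℕ) : ℝ) ^ 3 * xyZeroModeWeight (K N) N := by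
    have h1 : (1 - η) * (c * N) ≤ (1 - η) / ((K N : ℕ) : ℝ) ^ 3 * xyZeroModeWeight (K N) N := by
      rw [div_mul_eq_mul_div, le_div_iff₀ hMpos]
      calc (1 - η) * (c * N) * ((K N : ℕ) : ℝ) ^ 3
          = (1 - η) * (c * N * ((K N : ℕ) : ℝ) ^ 3) := by ring
        _ ≤ (1 - η) * xyZeroModeWeight (K N) N := mul_le_mul_of_nonneg_left hlat h1η.le
    have hN0 : (0 : ℝ) ≤ N := Nat.cast_nonneg N
    have hA : η * N ≤ c / 4 * N := mul_le_mul_of_nonneg_right hηc hN0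
    have hB : η * (c * N) ≤ 1 / 2 * (c * N) := mul_le_mul_of_nonneg_right hηh (by positivity)
    have h2 : c / 4 * N + η * N ≤ (1 - η) * (c * N) := by nlinarith [hA, hB]
    exact h2.trans h1
  have hsum : ENNReal.ofReal (c / 4 * N) + ENNReal.ofReal (η * N) ≤
      condensateOccupation N (sideLength ρ N) Ψ.ψ + ENNReal.ofReal (η * N) := by
    rw [← ENNReal.ofReal_add (by positivity) (by positivity)]
    exact (ENNReal.ofReal_le_ofReal hkey).trans hfloor
  exact (ENNReal.add_le_add_iff_right ENNReal.ofReal_ne_top).mp hsum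

/-- Shape check: the bet is stated so that, with `H`, it concludes the crux BY NAME. -/
example : DiluteEdgeFlatnessFloor → LatticeToPeriodicBridge :=
  latticeToPeriodicBridge_of_diluteEdgeFloor

end Summit.AtomisticToContinuum.BoseEinsteinCondensation.Cruxes.LatticeToPeriodicBridge.TaggedParticleRoughnessDomination

end
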